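import Literature.NumberTheory.LFunctions.EulerMaclaurinZeta
import Mathlib.Analysis.Real.Pi.Bounds
import HarnessLib

/-!
# Euler–Maclaurin summation for `ζ(s)` of arbitrary order on `Re s > 0`

Trunk T-ANT (NumberTheory/LFunctions). The tree's `EulerMaclaurinZeta.lean` proves Edwards'
formula (§6.4, eq. (1)) with `ν ≤ 2` correction terms. High-precision evaluation of `ζ` in the
critical strip (80 digits at height `t ≈ 2516`, as needed for the certified version of the
Odlyzko–te Riele computation, `MertensConjectureDisproof.lean`) needs the formula of *arbitrary*
order `ν` (there `ν ≈ 100`): for `Re s > 0`, `s ≠ 1`, `N ≥ 1`,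

  `ζ(s) = Σ_{n<N} n^{-s} + N^{1-s}/(s-1) + ½ N^{-s}`
  `        + Σ_{k=1}^{ν} (B_{2k}/(2k)!) s(s+1)⋯(s+2k-2) N^{-(s+2k-1)} + R_ν(s)`,
  `R_ν(s) = -(s(s+1)⋯(s+2ν)/(2ν+1)!) ∫_N^∞ B̄_{2ν+1}(x) x^{-(s+2ν+1)} dx`

(Edwards §6.4 (1); `B̄_k` the periodic Bernoulli function), obtained from the tree's order-zero
formula `Literature.NumberTheory.LFunctions.riemannZeta_eq_eulerMaclaurin₀` by iterating the integration-by-parts recursion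
`Literature.NumberTheory.LFunctions.bernoulliIntegral_eq_succ` twice per step (the odd Bernoulli numbers vanish), together with
the explicit remainder bound

  `‖R_ν(s)‖ ≤ ‖s(s+1)⋯(s+2ν)‖ · (π²/3) (2π)^{-(2ν+1)} · N^{-(Re s + 2ν)} / (Re s + 2ν)`   (`ν ≥ 1`)

from `|B̄_{2ν+1}(x)| ≤ (π²/3) (2ν+1)!/(2π)^{2ν+1}` (Mathlib's Fourier expansion
`hasSum_one_div_nat_pow_mul_sin` and `Σ n⁻² = π²/6`). Everything here is proved.

## Main definitions and results (namespace `Literature.RH`)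

* `emPoch s m = s(s+1)⋯(s+m-1)`; `emTerm N s k` (the `k`-th correction term);
  `emRemHigher N ν s = R_ν(s)`.
* `riemannZeta_eq_eulerMaclaurin_of_re_pos` — the formula of order `ν` on `Re s > 0`.
* `abs_bernoulliFun_odd_le`, `abs_bernoulliPer_odd_le` — `|B̄_{2k+1}| ≤ (π²/3)(2k+1)!/(2π)^{2k+1}`.
* `norm_emRemHigher_le` — the remainder bound above.

## References

* H. M. Edwards, *Riemann's Zeta Function*, Academic Press 1974, §6.4 eq. (1) and the remainder
  estimate following it. [Edwards1974]
-/

noncomputable section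

open Complex Filter Topology MeasureTheory Finset

namespace Literature.NumberTheory.LFunctions

/-! ## Pochhammer products and the terms of the formula -/

/-- `emPoch s m = s (s+1) ⋯ (s+m-1)` (empty product `= 1` for `m = 0`). [folklore] -/
def emPoch (s : ℂ) (m : ℕ) : ℂ := ∏ j ∈ range m, (s + j)

/-- [folklore] -/
@[simp] lemma emPoch_zero (s : ℂ) : emPoch s 0 = 1 := by simp [emPoch]

/-- [folklore] -/
lemma emPoch_succ (s : ℂ) (m : ℕ) : emPoch s (m + 1) = emPoch s m * (s + m) := by
  simp [emPoch, prod_range_succ]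

/-- [folklore] -/
lemma emPoch_one (s : ℂ) : emPoch s 1 = s := by simp [emPoch]

/-- The `k`-th Euler–Maclaurin correction term
`T_k(s) = (B_{2k}/(2k)!) · s(s+1)⋯(s+2k-2) · N^{-(s+2k-1)}` (`k ≥ 1`). [cite: Edwards1974, §6.4 eq. (1)] -/
def emTerm (N : ℕ) (s : ℂ) (k : ℕ) : ℂ :=
  (bernoulli (2 * k) : ℂ) / (2 * k).factorial * emPoch s (2 * k - 1) *
    (N : ℂ) ^ (-(s + ((2 * k - 1 : ℕ) : ℂ)))

/-- The Euler–Maclaurin remainder of order `ν`: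
`R_ν(s) = -(s(s+1)⋯(s+2ν)/(2ν+1)!) ∫_N^∞ B̄_{2ν+1}(x) x^{-(s+2ν+1)} dx`. [cite: Edwards1974, §6.4 eq. (1)] -/
def emRemHigher (N ν : ℕ) (s : ℂ) : ℂ :=
  -(emPoch s (2 * ν + 1) / (2 * ν + 1).factorial) * bernoulliIntegral (2 * ν + 1) N s

/-- Odd Bernoulli numbers beyond `B₁` vanish: `B_{2ν+3} = 0`. [folklore] -/
lemma bernoulli_two_mul_add_three (ν : ℕ) : bernoulli (2 * ν + 3) = 0 := by
  rw [bernoulli, bernoulli'_eq_zero_of_odd ⟨ν + 1, by ring⟩ (by omega), mul_zero]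

/-- One step of the recursion: `R_ν = T_{ν+1} + R_{ν+1}` on `Re s > 0`. [cite: Edwards1974, §6.4 eq. (1)] -/
theorem emRemHigher_eq_succ {N : ℕ} (hN : 1 ≤ N) {s : ℂ} (hs : 0 < s.re) (ν : ℕ) :
    emRemHigher N ν s = emTerm N s (ν + 1) + emRemHigher N (ν + 1) s := by
  have hJ1 := bernoulliIntegral_eq_succ (k := 2 * ν + 1) (by omega) hN (s := s)
    (by push_cast; linarith)
  have hJ2 := bernoulliIntegral_eq_succ (k := 2 * ν + 1 + 1) (by omega) hN (s := s)
    (by push_cast; linarith)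
  have hB : (bernoulli (2 * ν + 1 + 1 + 1) : ℂ) = 0 := by
    rw [show 2 * ν + 1 + 1 + 1 = 2 * ν + 3 by ring, bernoulli_two_mul_add_three]; simp
  have e1 : 2 * (ν + 1) - 1 = 2 * ν + 1 := by omega
  have e2 : 2 * (ν + 1) = 2 * ν + 1 + 1 := by ring
  rw [emRemHigher, emRemHigher, emTerm, e1, e2, hJ1, hJ2, hB]
  rw [emPoch_succ s (2 * ν + 1 + 1), emPoch_succ s (2 * ν + 1),
    Nat.factorial_succ (2 * ν + 1 + 1), Nat.factorial_succ (2 * ν + 1)]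
  have hf : ((2 * ν + 1).factorial : ℂ) ≠ 0 := by exact_mod_cast (Nat.factorial_pos _).ne'
  have h1 : (2 * (ν : ℂ) + 1 + 1) ≠ 0 := by norm_cast
  have h2 : (2 * (ν : ℂ) + 1 + 1 + 1) ≠ 0 := by norm_cast
  -- freeze the atoms
  generalize emPoch s (2 * ν + 1) = P
  generalize bernoulliIntegral (2 * ν + 1 + 1 + 1) N s = J
  generalize (N : ℂ) ^ (-(s + ((2 * ν + 1 : ℕ) : ℂ))) = X
  generalize (N : ℂ) ^ (-(s + ((2 * ν + 1 + 1 : ℕ) : ℂ))) = X'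
  generalize ((2 * ν + 1).factorial : ℕ) = F at hf ⊢
  push_cast
  field_simp
  ring

/-- **Euler–Maclaurin summation of order `ν` on `Re s > 0`** (`s ≠ 1`, `N ≥ 1`):
`ζ(s) = Σ_{n<N} n^{-s} + N^{1-s}/(s-1) + ½N^{-s} + Σ_{k=1}^{ν} T_k(s) + R_ν(s)`. [cite: Edwards1974, §6.4 eq. (1)] -/
theorem riemannZeta_eq_eulerMaclaurin_of_re_pos {N : ℕ} (hN : 1 ≤ N) {s : ℂ} (hs : 0 < s.re)
    (hs1 : s ≠ 1) (ν : ℕ) :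
    riemannZeta s =
      emMainZero N s + ∑ k ∈ Finset.Icc 1 ν, emTerm N s k + emRemHigher N ν s := by
  induction ν with
  | zero =>
    rw [riemannZeta_eq_eulerMaclaurin₀ hN hs hs1, emMainZero, emRemHigher]
    simp [emPoch_one]
    ring
  | succ ν ih =>
    rw [ih, emRemHigher_eq_succ hN hs ν, Finset.sum_Icc_succ_top (by omega)]
    ring

/-! ## The size of the odd periodic Bernoulli functions -/

/-- For `k ≥ 1` and `0 ≤ x ≤ 1`: `|B_{2k+1}(x)| ≤ (π²/3) · (2k+1)! / (2π)^{2k+1}`, from the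
Fourier expansion `B_{2k+1}(x) = (-1)^{k+1} 2(2k+1)!/(2π)^{2k+1} Σ_{n≥1} sin(2πnx)/n^{2k+1}`
and `Σ n^{-(2k+1)} ≤ Σ n^{-2} = π²/6`. [folklore] -/
theorem abs_bernoulliFun_odd_le {k : ℕ} (hk : k ≠ 0) {x : ℝ} (hx : x ∈ Set.Icc (0 : ℝ) 1) :
    |bernoulliFun (2 * k + 1) x| ≤
      Real.pi ^ 2 / 3 * ((2 * k + 1).factorial : ℝ) / (2 * Real.pi) ^ (2 * k + 1) := by
  have hS := hasSum_one_div_nat_pow_mul_sin hk hx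
  -- the constant in front of `B_{2k+1}(x)`
  set C : ℝ := (-1 : ℝ) ^ (k + 1) * (2 * Real.pi) ^ (2 * k + 1) / 2 / (2 * k + 1).factorial
    with hC
  have hπ : 0 < Real.pi := Real.pi_pos
  have h2π : 0 < (2 * Real.pi) ^ (2 * k + 1) := by positivity
  have hfac : (0 : ℝ) < (2 * k + 1).factorial := by exact_mod_cast Nat.factorial_pos _
  have hCabs : |C| = (2 * Real.pi) ^ (2 * k + 1) / 2 / (2 * k + 1).factorial := by
    rw [hC, abs_div, abs_div, abs_mul, abs_pow, abs_neg, abs_one, one_pow, one_mul,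
      abs_of_pos h2π, abs_of_pos (by norm_num : (0 : ℝ) < 2), abs_of_pos hfac]
  have hCne : C ≠ 0 := by
    intro h0
    rw [h0, abs_zero] at hCabs
    have : 0 < (2 * Real.pi) ^ (2 * k + 1) / 2 / (2 * k + 1).factorial := by positivity
    linarith
  -- the Fourier sum is bounded by `π²/6`
  have hB : ‖C * bernoulliFun (2 * k + 1) x‖ ≤ Real.pi ^ 2 / 6 := by
    have hmaj : HasSum (fun n : ℕ ↦ (1 : ℝ) / (n : ℝ) ^ 2) (Real.pi ^ 2 / 6) := hasSum_zeta_two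
    refine HasSum.norm_le_of_bounded hS hmaj fun n ↦ ?_
    rw [Real.norm_eq_abs, abs_mul]
    rcases Nat.eq_zero_or_pos n with rfl | hn
    · simp
    have hnr : (1 : ℝ) ≤ n := by exact_mod_cast hn
    calc |1 / (n : ℝ) ^ (2 * k + 1)| * |Real.sin (2 * Real.pi * n * x)|
        ≤ 1 / (n : ℝ) ^ (2 * k + 1) * 1 := by
          rw [abs_of_pos (by positivity)]
          exact mul_le_mul_of_nonneg_left (Real.abs_sin_le_one _) (by positivity)
      _ ≤ 1 / (n : ℝ) ^ 2 := by
          rw [mul_one]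
          apply one_div_le_one_div_of_le (by positivity)
          exact pow_le_pow_right₀ hnr (by omega)
  rw [norm_mul, Real.norm_eq_abs, Real.norm_eq_abs, hCabs] at hB
  -- solve for `|B|`
  have hCpos : 0 < (2 * Real.pi) ^ (2 * k + 1) / 2 / (2 * k + 1).factorial := by positivity
  rw [mul_comm] at hB
  have := (le_div_iff₀ hCpos).2 hB
  refine this.trans (le_of_eq ?_)
  field_simp
  ring

/-- For `ν ≥ 1`: `|B̄_{2ν+1}(x)| ≤ (π²/3) (2ν+1)!/(2π)^{2ν+1}` for all real `x`. [folklore] -/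
theorem abs_bernoulliPer_odd_le {ν : ℕ} (hν : ν ≠ 0) (x : ℝ) :
    |bernoulliPer (2 * ν + 1) x| ≤
      Real.pi ^ 2 / 3 * ((2 * ν + 1).factorial : ℝ) / (2 * Real.pi) ^ (2 * ν + 1) := by
  rw [bernoulliPer_def]
  exact abs_bernoulliFun_odd_le hν ⟨Int.fract_nonneg x, (Int.fract_lt_one x).le⟩

/-! ## The remainder bound -/

/-- **Remainder estimate of order `ν ≥ 1` on `Re s > 0`:**
`‖R_ν(s)‖ ≤ ‖s(s+1)⋯(s+2ν)‖ · (π²/3)(2π)^{-(2ν+1)} · N^{-(Re s + 2ν)} / (Re s + 2ν)`.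
[cite: Edwards1974, §6.4 (estimate after eq. (1))] -/
theorem norm_emRemHigher_le {N : ℕ} (hN : 1 ≤ N) {s : ℂ} (hs : 0 < s.re) {ν : ℕ} (hν : ν ≠ 0) :
    ‖emRemHigher N ν s‖ ≤
      ‖emPoch s (2 * ν + 1)‖ * (Real.pi ^ 2 / 3 / (2 * Real.pi) ^ (2 * ν + 1)) *
        ((N : ℝ) ^ (-(s.re + 2 * ν)) / (s.re + 2 * ν)) := by
  set β : ℝ := Real.pi ^ 2 / 3 * ((2 * ν + 1).factorial : ℝ) / (2 * Real.pi) ^ (2 * ν + 1)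
    with hβ
  have hβb : ∀ x, |bernoulliPer (2 * ν + 1) x| ≤ β := abs_bernoulliPer_odd_le hν
  have hk : 1 - ((2 * ν + 1 : ℕ) : ℝ) < s.re := by push_cast; linarith
  have hJ := norm_bernoulliLogIntegral_zero_le hβb hN hk
  rw [bernoulliLogIntegral_zero] at hJ
  have hfac : (0 : ℝ) < (2 * ν + 1).factorial := by exact_mod_cast Nat.factorial_pos _
  have ha : 0 < s.re + 2 * ν := by positivity
  have hN0 : (0 : ℝ) < N := by exact_mod_cast hN
  have e1 : s.re + ((2 * ν + 1 : ℕ) : ℝ) - 1 = s.re + 2 * ν := by push_cast; ring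
  rw [e1] at hJ
  unfold emRemHigher
  rw [norm_mul, norm_neg, norm_div, Complex.norm_natCast]
  have hP : 0 ≤ ‖emPoch s (2 * ν + 1)‖ := norm_nonneg _
  have hQ : 0 ≤ (N : ℝ) ^ (-(s.re + 2 * ν)) / (s.re + 2 * ν) :=
    div_nonneg (Real.rpow_nonneg hN0.le _) ha.le
  calc ‖emPoch s (2 * ν + 1)‖ / ((2 * ν + 1).factorial : ℝ) * ‖bernoulliIntegral (2 * ν + 1) N s‖
      ≤ ‖emPoch s (2 * ν + 1)‖ / ((2 * ν + 1).factorial : ℝ) *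
          (β * ((N : ℝ) ^ (-(s.re + 2 * ν)) / (s.re + 2 * ν))) :=
        mul_le_mul_of_nonneg_left hJ (by positivity)
    _ = _ := by
        rw [hβ]
        field_simp

/-- The remainder bound with the factor `(π²/3)(2π)^{-(2ν+1)}` replaced by the rational majorant
`(33/10) · (25/157)^{2ν+1}` (`π² < 9.9`, `2π > 157/25`), and `N^{-(Re s + 2ν)} ≤ N^{-2ν}`,
`1/(Re s + 2ν) ≤ 1/(2ν)`: the form evaluated by certified computations. [folklore] -/
theorem norm_emRemHigher_le_rat {N : ℕ} (hN : 1 ≤ N) {s : ℂ} (hs : 0 < s.re) {ν : ℕ} (hν : ν ≠ 0) :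
    ‖emRemHigher N ν s‖ ≤
      ‖emPoch s (2 * ν + 1)‖ * ((33 / 10 : ℝ) * (25 / 157) ^ (2 * ν + 1)) *
        (1 / ((N : ℝ) ^ (2 * ν) * (2 * ν))) := by
  refine (norm_emRemHigher_le hN hs hν).trans ?_
  have hN0 : (0 : ℝ) < N := by exact_mod_cast hN
  have hN1 : (1 : ℝ) ≤ N := by exact_mod_cast hN
  have hν0 : (0 : ℝ) < ν := by exact_mod_cast Nat.pos_of_ne_zero hν
  have hπ3 := Real.pi_gt_d2
  have hπ4 := Real.pi_lt_d4
  have h1 : Real.pi ^ 2 / 3 / (2 * Real.pi) ^ (2 * ν + 1) ≤ (33 / 10 : ℝ) * (25 / 157) ^ (2 * ν + 1) := by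
    rw [div_le_iff₀ (by positivity)]
    have hA : Real.pi ^ 2 / 3 ≤ 33 / 10 := by nlinarith
    have hB : (1 : ℝ) ≤ (25 / 157) ^ (2 * ν + 1) * (2 * Real.pi) ^ (2 * ν + 1) := by
      rw [← mul_pow]
      exact one_le_pow₀ (by nlinarith)
    nlinarith
  have h2 : (N : ℝ) ^ (-(s.re + 2 * ν)) / (s.re + 2 * ν) ≤ 1 / ((N : ℝ) ^ (2 * ν) * (2 * ν)) := by
    rw [div_le_div_iff₀ (by positivity) (by positivity), one_mul]
    have hr : (N : ℝ) ^ (-(s.re + 2 * ν)) * (N : ℝ) ^ (2 * ν) ≤ 1 := by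
      rw [← Real.rpow_natCast, ← Real.rpow_add hN0]
      push_cast
      rw [show -(s.re + 2 * ν) + 2 * (ν : ℝ) = -s.re by ring]
      exact Real.rpow_le_one_of_one_le_of_nonpos hN1 (by linarith)
    have hpos : (0 : ℝ) ≤ (N : ℝ) ^ (-(s.re + 2 * ν)) := Real.rpow_nonneg hN0.le _
    calc (N : ℝ) ^ (-(s.re + 2 * ν)) * ((N : ℝ) ^ (2 * ν) * (2 * ν))
        = ((N : ℝ) ^ (-(s.re + 2 * ν)) * (N : ℝ) ^ (2 * ν)) * (2 * ν) := by ring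
      _ ≤ 1 * (2 * ν) := by gcongr
      _ ≤ s.re + 2 * ν := by linarith
  have hP : 0 ≤ ‖emPoch s (2 * ν + 1)‖ := norm_nonneg _
  have hQ : 0 ≤ (N : ℝ) ^ (-(s.re + 2 * ν)) / (s.re + 2 * ν) :=
    div_nonneg (Real.rpow_nonneg hN0.le _) (by positivity)
  exact mul_le_mul (mul_le_mul_of_nonneg_left h1 hP) h2 hQ (by positivity)

/-- The Pochhammer norm is bounded by the product of `|Re s + j| + |Im s|`. [folklore] -/
theorem norm_emPoch_le (s : ℂ) (m : ℕ) :
    ‖emPoch s m‖ ≤ ∏ j ∈ range m, (|s.re + j| + |s.im|) := by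
  unfold emPoch
  rw [norm_prod]
  refine prod_le_prod (fun _ _ ↦ norm_nonneg _) fun j _ ↦ ?_
  have := Complex.norm_le_abs_re_add_abs_im (s + j)
  simpa using this

end Literature.NumberTheory.LFunctions
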